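import Literature.NumberTheory.EllipticCurves.HeegnerPointsKolyvaginSplitDescentPairData
import HarnessLib

/-!
# McCallum's split descent data with the eigen-labels negated (`ε ↦ −ε`, `V^{ν} ↦ V^{−ν}`)

The axioms of `KolyvaginDescent.SplitDataM` [McCallumLMS1991, §5, proof of Thm. 5.4] are symmetric under
relabelling the two eigenspaces of the involution: replacing `ε` by `−ε` and `eig ν` by `eig (−ν)` carries split
descent data to split descent data with the same Selmer group, local conditions, Kolyvagin primes, classes
`c(n)`, `x` and `M₀` (the class `c(n)` lies in `eig (ε (−1)^{|n|})` iff it lies in the relabelled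
`eig (−(−ε (−1)^{|n|}))`). This is the bookkeeping that lets ONE abstract telescope, stated for a sign `ε` with
`Sd.ε = ε`, serve both root-number branches of Kolyvagin's pair `(E, E^D)` over `ℚ` at `p = 2`
[Kolyvagin1989Izv, §3]: the two-member data `PairDataM.toSplitData` labels the member holding `x` by `+1`;
when that member is the twist `E^D` (the class of `y_K` is `τ`-anti-invariant, i.e. `ε(E/ℚ) = +1` in
[GrossLMS1991, §5 (5.2), Prop. 5.4 (2)]), its image in `H¹(K, E[2^M])` is the `−1`-eigenspace, and
`toSplitData.negSign` carries the matching labels (`ε = −1`, `eig (−1) = V₁ × 0`, `eig 1 = 0 × V₂`).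

* `SplitDataM.negSign` with its unfolding lemmas; `PairDataM.mem_toSplitData_negSign_eig_neg_one_iff`,
  `PairDataM.mem_toSplitData_negSign_eig_one_iff`.

## References

* W. G. McCallum, *Kolyvagin's work on Shafarevich–Tate groups*, LMS Lecture Note Ser. 153 (1991) 295–316,
  §5 (the data of the proof of Thm. 5.4). [McCallumLMS1991]
* B. H. Gross, *Kolyvagin's work on modular elliptic curves*, same volume, §5 (5.2) and Prop. 5.4 (2)
  (`y_K^σ = ε y_K` up to torsion, `c(n)^σ = ε (−1)^{|n|} c(n)`). [GrossLMS1991]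
* V. A. Kolyvagin, *On the Mordell–Weil group and the Shafarevich–Tate group of modular elliptic curves*,
  Izv. 1989, §3 (the pair `(E, E^D)` over `ℚ` at `l = 2`). [Kolyvagin1989Izv]
-/

noncomputable section

open scoped Classical

namespace Literature.NumberTheory.EllipticCurves

namespace KolyvaginDescent

namespace SplitDataM

variable {V : Type*} [AddCommGroup V] {Pl : Type*} (S : SplitDataM V Pl)

/-- **The split descent data with the eigen-labels negated**: `ε ↦ −ε`, `eig ν ↦ eig (−ν)`, every other
field unchanged (McCallum's data of the proof of Thm. 5.4 is symmetric under renaming the two eigenspaces of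
the involution). [cite: McCallumLMS1991, §5 Thm. 5.4 (proof: the data `S, S^±, x, c(n), M₀`)]
[cite: GrossLMS1991, Prop. 5.4 (2)] -/
def negSign : SplitDataM V Pl where
  p := S.p
  hp := S.hp
  M := S.M
  torsion := S.torsion
  eig ν := S.eig (-ν)
  eig_disjoint v h₁ h₂ := by
    have h₂' : v ∈ S.eig 1 := by simpa using h₂
    exact S.eig_disjoint v h₂' h₁
  Sel := S.Sel
  sel_split s hs := by
    obtain ⟨s₁, s₂, ⟨h₁, e₁⟩, ⟨h₂, e₂⟩, hs'⟩ := S.sel_split s hs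
    exact ⟨s₂, s₁, ⟨h₂, by simpa using e₂⟩, ⟨h₁, by simpa using e₁⟩, by rw [hs', add_comm]⟩
  Loc := S.Loc
  mem_sel_iff := S.mem_sel_iff
  Kol := S.Kol
  prime_of_kol := S.prime_of_kol
  pl := S.pl
  Dv := S.Dv
  dv_iff := S.dv_iff
  dv_mul := S.dv_mul
  A := S.A
  x := S.x
  x_mem := S.x_mem
  x_ord := S.x_ord
  M₀ := S.M₀
  ε := -S.ε
  hε := by
    rcases S.hε with h | h
    · exact Or.inr (by rw [h])
    · exact Or.inl (by rw [h, neg_neg])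
  x_eig := by
    show S.x ∈ S.eig (-(-S.ε))
    rw [neg_neg]
    exact S.x_eig
  c := S.c
  c_one := S.c_one
  c_eig n hn := by
    show S.c n ∈ S.eig (-(-S.ε * (-1) ^ n.primeFactors.card))
    rw [neg_mul, neg_neg]
    exact S.c_eig n hn
  c_mem_loc := S.c_mem_loc
  c_mem_loc_iff := S.c_mem_loc_iff

/-! ### Unfolding lemmas -/

/-- `negSign.p = p`. [cite: McCallumLMS1991, §5 Thm. 5.4 (proof)] -/
@[simp] theorem negSign_p : S.negSign.p = S.p := rfl

/-- `negSign.M = M`. [cite: McCallumLMS1991, §5 Thm. 5.4 (proof)] -/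
@[simp] theorem negSign_M : S.negSign.M = S.M := rfl

/-- `negSign.M₀ = M₀`. [cite: McCallumLMS1991, Lemma 5.1] -/
@[simp] theorem negSign_M₀ : S.negSign.M₀ = S.M₀ := rfl

/-- `negSign.ε = −ε`. [cite: GrossLMS1991, Prop. 5.4 (2)] -/
@[simp] theorem negSign_ε : S.negSign.ε = -S.ε := rfl

/-- `negSign.x = x`. [cite: McCallumLMS1991, §5 Thm. 5.4 (proof)] -/
@[simp] theorem negSign_x : S.negSign.x = S.x := rfl

/-- `negSign.c = c`. [cite: McCallumLMS1991, §5 Thm. 5.4 (proof)] -/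
@[simp] theorem negSign_c (n : ℕ) : S.negSign.c n = S.c n := rfl

/-- `negSign.Sel = Sel`. [cite: McCallumLMS1991, §4] -/
@[simp] theorem negSign_sel : S.negSign.Sel = S.Sel := rfl

/-- `negSign.Loc = Loc`. [cite: McCallumLMS1991, §4] -/
@[simp] theorem negSign_loc (w : Pl) : S.negSign.Loc w = S.Loc w := rfl

/-- `negSign.A = A`. [cite: McCallumLMS1991, §5 (19)] -/
@[simp] theorem negSign_A (ℓ : ℕ) : S.negSign.A ℓ = S.A ℓ := rfl

/-- `negSign.pl = pl`. [cite: McCallumLMS1991, §3] -/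
@[simp] theorem negSign_pl (ℓ : ℕ) : S.negSign.pl ℓ = S.pl ℓ := rfl

/-- `negSign.Dv = Dv`. [cite: McCallumLMS1991, §3] -/
theorem negSign_dv_iff (w : Pl) (n : ℕ) : S.negSign.Dv w n ↔ S.Dv w n := Iff.rfl

/-- `negSign.Kol = Kol`. [cite: McCallumLMS1991, §3] -/
theorem negSign_kol_iff (ℓ : ℕ) : S.negSign.Kol ℓ ↔ S.Kol ℓ := Iff.rfl

/-- `KolSupp negSign.Kol = KolSupp Kol`. [cite: McCallumLMS1991, §3] -/
theorem kolSupp_negSign_iff (n : ℕ) : KolSupp S.negSign.Kol n ↔ KolSupp S.Kol n := Iff.rfl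

/-- `v ∈ negSign.eig ν ↔ v ∈ eig (−ν)`. [cite: GrossLMS1991, Prop. 5.4 (2)] -/
theorem mem_negSign_eig_iff (ν : ℤ) (v : V) : v ∈ S.negSign.eig ν ↔ v ∈ S.eig (-ν) := Iff.rfl

/-- `negSign.expo = expo` (same `p`, same torsion). [cite: McCallumLMS1991, §5 (Thm. 5.4: orders `ord d = p^{N}`)] -/
theorem negSign_expo (s : V) : S.negSign.expo s = S.expo s := rfl

end SplitDataM

namespace PairDataM

variable {V₁ V₂ : Type*} [AddCommGroup V₁] [AddCommGroup V₂] {Pl : Type*} (S : PairDataM V₁ V₂ Pl)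

/-- On the two-member data with negated labels, `eig (−1)` is the member holding `x`: `v ∈ eig (−1) ↔ v.2 = 0`
(the branch where that member is the twist `E^D`, whose classes are `τ`-anti-invariant in `H¹(K, E[2^M])`).
[cite: Kolyvagin1989Izv, §3] [cite: GrossLMS1991, Prop. 5.4 (2)] -/
theorem mem_toSplitData_negSign_eig_neg_one_iff (v : V₁ × V₂) :
    v ∈ S.toSplitData.negSign.eig (-1) ↔ v.2 = 0 := by
  rw [SplitDataM.mem_negSign_eig_iff, neg_neg]
  exact S.mem_toSplitData_eig_one_iff v

/-- On the two-member data with negated labels, `v ∈ eig 1 ↔ v.1 = 0`. [cite: Kolyvagin1989Izv, §3]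
[cite: GrossLMS1991, Prop. 5.4 (2)] -/
theorem mem_toSplitData_negSign_eig_one_iff (v : V₁ × V₂) :
    v ∈ S.toSplitData.negSign.eig 1 ↔ v.1 = 0 :=
  S.mem_toSplitData_eig_neg_one_iff v

/-- `toSplitData.negSign.ε = −1`. [cite: GrossLMS1991, Prop. 5.4 (2)] -/
@[simp] theorem toSplitData_negSign_ε : S.toSplitData.negSign.ε = -1 := rfl

end PairDataM

end KolyvaginDescent

end Literature.NumberTheory.EllipticCurves

end
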